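import Summits.CriticalPhenomena.PercolationContinuityZ3.Theorems.PercNearOneGluingNoHeavyLowerTailSahiC3CubeEvents

/-!
# `NoHeavyLowerTail` (crux stmt-CriticalPhenomena-4575), Sahi programme P1: `C₃` on `{0,1}³` for every FKG measure —
# preliminaries (symmetry and easy classes of `latticeE3`; bitmask codes of finite sets of cube points; masses from codes)

Support file (Sahi cell, seat `prim-sahi-p1`; `--supports stmt-CriticalPhenomena-4575`).  Used by `…SahiC3CubeThreeFKG`, which proves
Sahi's conjecture `C₃` (Combinatorica 28 (2008), Conj. 5 at `n = 3`) on the Boolean lattice `{0,1}³` for every log-supermodular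
weight.  Contents (no facts, no sorries):

* `latticeE3_comm₁₂/₂₃/₁₃`, `latticeE3_empty` (`E₃ = 0` with an empty slot), `latticeE3_univ_nonneg` (a full slot: the FKG
  covariance), `latticeE3_nonneg_of_subset` (a nested pair; only the FKG inequality for the remaining pair is used) — valid on any
  finite distributive lattice (`Literature.Probability.LatticeModels.latticeE3`, `fkg_upperSet_mass`);
* `ptB`, `encF`, `testBit_encF`, `mem_iff_testBit_encF`, `encF_inter`, `encF_univ`, `isUpN_encF`, `encF_mem_upsN`,
  `eq_empty_of_encF`, `eq_univ_of_encF`, `subset_of_encF` — finite sets of points of `Fin m → Bool` ↔ bitmask codes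
  (`ofBits`, `enc2`, `isUpN`, `upsN` of `…SahiC3CubeEvents` / `…CertCheck`);
* `bitsL`, `massL`, `mass_eq_massL` — the mass of a finite set of cube points is the sum of the weights of the points whose codes are
  the set bits of its code (so that masses of explicitly coded sets evaluate by `decide` + `simp`).
-/

namespace Summit.CriticalPhenomena.PercolationContinuityZ3.Theorems.SahiC3Cube

open Finset OneCutCert Literature.Probability.LatticeModels
open scoped BigOperators

/-! ## `latticeE3`: symmetry and the easy classes (any finite distributive lattice) -/

section General

variable {α : Type*}

/-- `latticeE3` is symmetric in its first two arguments. [folklore] -/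
theorem latticeE3_comm₁₂ [Fintype α] [DecidableEq α] (μ : α → ℝ) (A B C : Finset α) :
    latticeE3 μ A B C = latticeE3 μ B A C := by
  unfold latticeE3; rw [Finset.inter_comm A B]; ring

/-- `latticeE3` is symmetric in its last two arguments. [folklore] -/
theorem latticeE3_comm₂₃ [Fintype α] [DecidableEq α] (μ : α → ℝ) (A B C : Finset α) :
    latticeE3 μ A B C = latticeE3 μ A C B := by
  unfold latticeE3; rw [Finset.inter_assoc, Finset.inter_comm B C, ← Finset.inter_assoc]; ring

/-- `latticeE3` is symmetric in its outer two arguments. [folklore] -/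
theorem latticeE3_comm₁₃ [Fintype α] [DecidableEq α] (μ : α → ℝ) (A B C : Finset α) :
    latticeE3 μ A B C = latticeE3 μ C B A := by
  rw [latticeE3_comm₁₂, latticeE3_comm₂₃, latticeE3_comm₁₂]

/-- An empty slot: `latticeE3 μ ∅ B C = 0`. [folklore] -/
theorem latticeE3_empty [Fintype α] [DecidableEq α] (μ : α → ℝ) (B C : Finset α) : latticeE3 μ ∅ B C = 0 := by
  unfold latticeE3 mass; simp

/-- A full slot: `latticeE3 μ univ B C = Z·(Z·m(B∩C) − m(B)m(C)) ≥ 0` for up-sets under a log-supermodular weight (the FKG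
covariance; Sahi's branching rule `E₃(f,g,1) = E₂(f,g)`). [cite: LiebSahi2021, Prop. 3.3 (arXiv p. 8)] -/
theorem latticeE3_univ_nonneg [DistribLattice α] [Fintype α] [DecidableEq α] {μ : α → ℝ} (hμ₀ : 0 ≤ μ)
    (hμ : ∀ a b, μ a * μ b ≤ μ (a ⊓ b) * μ (a ⊔ b)) {B C : Finset α} (hB : IsUpperSet (B : Set α))
    (hC : IsUpperSet (C : Set α)) : 0 ≤ latticeE3 μ univ B C := by
  have h := fkg_upperSet_mass hμ₀ hμ hB hC
  have key : latticeE3 μ univ B C = mass μ univ * (mass μ univ * mass μ (B ∩ C) - mass μ B * mass μ C) := by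
    unfold latticeE3; simp only [Finset.univ_inter]; ring
  rw [key]; exact mul_nonneg (mass_nonneg hμ₀ _) (sub_nonneg.2 h)

/-- A nested pair `A ⊆ B`: `latticeE3 μ A B C = (Z·m(A∩C) − m(A)m(C))(2Z − m(B)) + Z·m(A)(m(C) − m(B∩C)) ≥ 0` for up-sets
`A, C` under a log-supermodular weight. [folklore] -/
theorem latticeE3_nonneg_of_subset [DistribLattice α] [Fintype α] [DecidableEq α] {μ : α → ℝ} (hμ₀ : 0 ≤ μ)
    (hμ : ∀ a b, μ a * μ b ≤ μ (a ⊓ b) * μ (a ⊔ b)) {A B C : Finset α} (hAB : A ⊆ B) (hA : IsUpperSet (A : Set α))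
    (hC : IsUpperSet (C : Set α)) : 0 ≤ latticeE3 μ A B C := by
  have h := fkg_upperSet_mass hμ₀ hμ hA hC
  have hZ := mass_nonneg hμ₀ (univ : Finset α)
  have hBZ : mass μ B ≤ mass μ univ := mass_mono hμ₀ (Finset.subset_univ B)
  have hBC : mass μ (B ∩ C) ≤ mass μ C := mass_mono hμ₀ Finset.inter_subset_right
  have key : latticeE3 μ A B C = (mass μ univ * mass μ (A ∩ C) - mass μ A * mass μ C) * (2 * mass μ univ - mass μ B) +
      mass μ univ * mass μ A * (mass μ C - mass μ (B ∩ C)) := by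
    unfold latticeE3; rw [Finset.inter_eq_left.2 hAB]; ring
  rw [key]
  exact add_nonneg (mul_nonneg (sub_nonneg.2 h) (by linarith))
    (mul_nonneg (mul_nonneg hZ (mass_nonneg hμ₀ A)) (sub_nonneg.2 hBC))

end General

/-! ## Finite sets of cube points ↔ bitmask codes -/

/-- The point of the `m`-cube whose coordinates are the bits of `x`. [this work] -/
def ptB (m x : ℕ) : Fin m → Bool := fun i => x.testBit i

/-- `ptB` inverts the corner position `enc2`. [this work] -/
theorem ptB_enc2 {m : ℕ} (g : Fin m → Bool) : ptB m (enc2 g) = g := by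
  funext i; rw [ptB, testBit_enc2, dif_pos i.2]

/-- `ptB m` is injective on codes `< 2^m`. [this work] -/
theorem ptB_injOn {m x y : ℕ} (hx : x < 2 ^ m) (hy : y < 2 ^ m) (h : ptB m x = ptB m y) : x = y := by
  refine Nat.eq_of_testBit_eq fun i => ?_
  by_cases hi : i < m
  · exact congrFun h ⟨i, hi⟩
  · have hle : 2 ^ m ≤ 2 ^ i := Nat.pow_le_pow_right (by norm_num) (not_lt.1 hi)
    rw [Nat.testBit_lt_two_pow (lt_of_lt_of_le hx hle), Nat.testBit_lt_two_pow (lt_of_lt_of_le hy hle)]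

open Classical in
/-- The bitmask code of a finite set of points of the `m`-cube: bit `x < 2^m` is set iff `ptB m x ∈ A`. [this work] -/
noncomputable def encF (m : ℕ) (A : Finset (Fin m → Bool)) : ℕ := ofBits (fun x => decide (ptB m x ∈ A)) (2 ^ m)

/-- `encF m A < 2^(2^m)`. [this work] -/
theorem encF_lt (m : ℕ) (A : Finset (Fin m → Bool)) : encF m A < 2 ^ (2 ^ m) := ofBits_lt _ _

open Classical in
/-- The bits of `encF`. [this work] -/
theorem testBit_encF (m : ℕ) (A : Finset (Fin m → Bool)) (x : ℕ) :
    (encF m A).testBit x = (decide (x < 2 ^ m) && decide (ptB m x ∈ A)) := by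
  unfold encF; rw [testBit_ofBits]

/-- Membership is the bit at the corner position. [this work] -/
theorem mem_iff_testBit_encF {m : ℕ} (A : Finset (Fin m → Bool)) (g : Fin m → Bool) :
    g ∈ A ↔ (encF m A).testBit (enc2 g) = true := by
  rw [testBit_encF, ptB_enc2]; simp [enc2_lt g]

/-- Codes of intersections are bitwise ANDs. [this work] -/
theorem encF_inter {m : ℕ} (A B : Finset (Fin m → Bool)) : encF m (A ∩ B) = encF m A &&& encF m B := by
  refine Nat.eq_of_testBit_eq fun x => ?_
  rw [Nat.testBit_land, testBit_encF, testBit_encF, testBit_encF]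
  by_cases h : x < 2 ^ m <;> by_cases hA : ptB m x ∈ A <;> by_cases hB : ptB m x ∈ B <;>
    simp [h, hA, hB, Finset.mem_inter]

/-- The code of the whole cube. [this work] -/
theorem encF_univ (m : ℕ) : encF m (univ : Finset (Fin m → Bool)) = 2 ^ (2 ^ m) - 1 := by
  refine Nat.eq_of_testBit_eq fun x => ?_
  rw [testBit_encF, Nat.testBit_two_pow_sub_one]
  simp

/-- An up-set has an increasing code. [this work] -/
theorem isUpN_encF {m : ℕ} {A : Finset (Fin m → Bool)} (hA : IsUpperSet (A : Set (Fin m → Bool))) :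
    isUpN m (encF m A) = true := by
  classical
  unfold isUpN
  simp only [List.all_eq_true, List.mem_range, Bool.or_eq_true, Bool.not_eq_true']
  intro x hx i hi
  by_cases hxA : (encF m A).testBit x = true
  · right
    rw [testBit_encF] at hxA ⊢
    simp only [Bool.and_eq_true, decide_eq_true_eq] at hxA ⊢
    refine ⟨Nat.or_lt_two_pow hxA.1 (Nat.pow_lt_pow_right (by norm_num) hi), ?_⟩
    have hle : ptB m x ≤ ptB m (x ||| 2 ^ i) := by
      intro j
      show x.testBit j ≤ (x ||| 2 ^ i).testBit j
      rw [Nat.testBit_or]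
      exact Bool.left_le_or _ _
    exact hA hle hxA.2
  · left
    rw [Bool.not_eq_true] at hxA
    exact hxA

/-- The code of an up-set is listed in `upsN`. [this work] -/
theorem encF_mem_upsN {m : ℕ} {A : Finset (Fin m → Bool)} (hA : IsUpperSet (A : Set (Fin m → Bool))) :
    encF m A ∈ upsN m := by
  unfold upsN
  rw [List.mem_filter, List.mem_range]
  exact ⟨encF_lt m A, isUpN_encF hA⟩

/-- Code `0` is the empty set. [this work] -/
theorem eq_empty_of_encF {m : ℕ} {A : Finset (Fin m → Bool)} (h : encF m A = 0) : A = ∅ := by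
  ext g
  rw [mem_iff_testBit_encF, h, Nat.zero_testBit]
  simp

/-- Code `2^(2^m) − 1` is the whole cube. [this work] -/
theorem eq_univ_of_encF {m : ℕ} {A : Finset (Fin m → Bool)} (h : encF m A = 2 ^ (2 ^ m) - 1) : A = univ := by
  ext g
  rw [mem_iff_testBit_encF, h, Nat.testBit_two_pow_sub_one]
  simp [enc2_lt g]

/-- Nested codes give nested sets. [this work] -/
theorem subset_of_encF {m : ℕ} {A B : Finset (Fin m → Bool)} (h : encF m A &&& encF m B = encF m A) : A ⊆ B := by
  intro g hg
  rw [mem_iff_testBit_encF] at hg ⊢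
  have := congrArg (fun n => Nat.testBit n (enc2 g)) h
  simp only [Nat.testBit_land, hg] at this
  simpa using this

/-! ## Masses from codes -/

/-- The set bits of `a` below `N`, in increasing order. [this work] -/
def bitsL (N a : ℕ) : List ℕ := (List.range N).filter fun j => a.testBit j

/-- The sum of the weights of the cube points with the listed codes. [this work] -/
def massL (m : ℕ) (μ : (Fin m → Bool) → ℝ) (l : List ℕ) : ℝ := (l.map fun j => μ (ptB m j)).sum

/-- A finite set of cube points is the image of the set bits of its code. [this work] -/
theorem eq_image_bitsL {m : ℕ} (A : Finset (Fin m → Bool)) :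
    A = ((bitsL (2 ^ m) (encF m A)).toFinset).image (ptB m) := by
  classical
  ext g
  simp only [Finset.mem_image, List.mem_toFinset, bitsL, List.mem_filter, List.mem_range, testBit_encF,
    Bool.and_eq_true, decide_eq_true_eq]
  constructor
  · intro hg
    exact ⟨enc2 g, ⟨enc2_lt g, enc2_lt g, by rwa [ptB_enc2]⟩, ptB_enc2 g⟩
  · rintro ⟨j, ⟨_, _, hj⟩, rfl⟩
    exact hj

/-- **Mass from the code**: `m(A) = Σ_{j a set bit of encF m A} μ (ptB m j)`. [this work] -/
theorem mass_eq_massL {m : ℕ} (μ : (Fin m → Bool) → ℝ) (A : Finset (Fin m → Bool)) :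
    mass μ A = massL m μ (bitsL (2 ^ m) (encF m A)) := by
  classical
  have hnd : (bitsL (2 ^ m) (encF m A)).Nodup := (List.nodup_range).filter _
  have hinj : Set.InjOn (ptB m) ↑((bitsL (2 ^ m) (encF m A)).toFinset) := by
    intro x hx y hy hxy
    simp only [Finset.mem_coe, List.mem_toFinset, bitsL, List.mem_filter, List.mem_range] at hx hy
    exact ptB_injOn hx.1 hy.1 hxy
  unfold mass massL
  conv_lhs => rw [eq_image_bitsL A]
  rw [Finset.sum_image hinj, List.sum_toFinset _ hnd]

end Summit.CriticalPhenomena.PercolationContinuityZ3.Theorems.SahiC3Cube
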